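import Literature.Computability.AlgebraicComplexity.ConstrainedMatMulSandwich
import HarnessLib

/-!
# Constrained matrix multiplication: the transpose symmetry (Wang 2026, §4.1 with Lemma 1)

Topic `Literature/Computability/AlgebraicComplexity`. PROVED, no named facts.

Wang 2026 bounds `R(⟨l,m,n⟩)` from below through the tensors `T_S` obtained by constraining the
first argument `X` to a subspace `S` (§3.2), one representative per orbit of the first-argument
symmetry group (Lemma 1: `R(T_S) = R(T_{g(S)})` for a rank-preserving first-argument symmetry `g`).
For a square format the sandwich maps `X ↦ P X Q⁻¹` are joined by the order-two **transpose
symmetry** `X ↦ Xᵀ, Y ↦ Zᵀ, Z ↦ Yᵀ` (§4.1: "for a square format `l = m = n` this combines with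
matrix transposition into an order-two symmetry"; the `3 × 3` orbit tables of Table 9 and the
published `⟨3,3,3⟩` certificates are reduced by it, `G = (GL_l × GL_m) ⋊ C_2`).

In the language of bilinear computations (Bläser 2003, Def. 1; a computation of `(X, Y) ↦ XY` on
`S × k^{c×n}` is a `BilinComp (mulBilin k c c n ∘ S.subtype)`), the transpose symmetry is the
following transport, which exchanges the roles of the second argument and of the output: from
`x' y' = Σ_t f_t(x') g_t(y') w_t` for `x' ∈ S'`, one gets for every `x'` and `y ∈ k^{c×n}`

  `x'ᵀ y = Σ_t f_t(x') ⟨w_t, y⟩ G_t`,  `⟨w, y⟩ = Σ_{a,d} w_{ad} y_{ad}`,  `(G_t)_{id} = g_t(E_{id})`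

(pair the identity `x' E_{id} = Σ_t f_t(x') g_t(E_{id}) w_t` with `y` entrywise:
`⟨x' E_{id}, y⟩ = Σ_a x'_{ai} y_{ad} = (x'ᵀ y)_{id}`), hence, composing with a sandwich, a
computation of `XY` on `S × k^{c×n}` of the same length whenever `P xᵀ Q ∈ S'` for all `x ∈ S`
(`P, Q` invertible): `x y = Q'ᵀ ((P xᵀ Q)ᵀ (P'ᵀ y))` with `P' P = 1`, `Q Q' = 1`.  Only the FIRST
factor has to be square (`c = m`); `n` is arbitrary (Wang states the symmetry for `l = m = n`, where
it is moreover a symmetry of the single tensor `⟨n,n,n⟩`).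

* `entryForm` — the entrywise pairing `w ↦ ⟨w, ·⟩`; `trMulBilin` — `(x', y) ↦ x'ᵀ y`;
* `BilinComp.transposeDual` — the core transport (`x' y'` on `S'` ⇒ `x'ᵀ y` on `S'`, same index set);
* `BilinComp.ofTransposeSandwichLE` — `P Sᵀ Q ⊆ S'` ⇒ (computation on `S'` ⇒ computation on `S`);
* `exists_bilinComp_constrained_of_transposeSandwich`, `exists_bilinComp_constrained_of_transpose`
  — the length statements (the sibling of `exists_bilinComp_constrained_of_sandwich`).

A certificate checker uses this exactly like the sandwich lookup: an explicit witness `(P, Q)` and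
the finitely many membership checks `P x_jᵀ Q ∈ S'` for a basis (or all elements) `x_j` of `S`.

## References

* C. Wang, *Automated Lower Bounds for Bilinear Complexity over Finite Fields*, arXiv:2603.07280
  (2026), §3.3 (Lemma 1), §4.1 (sandwich, cyclic and transpose symmetries;
  `G = (GL_l × GL_m) ⋊ C_2`), App. Table 9. [Wang2026]
* M. Bläser, J. Complexity 19 (2003) 43–60, §3 (equivalent computations, transposed
  computation). [Blaser2003]
-/

namespace Literature.Computability.AlgebraicComplexity

open Module Matrix

variable {k : Type*} [Field k] {c n : ℕ} {ι : Type*} [Fintype ι]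

/-! ## The entrywise pairing and the map `(x', y) ↦ x'ᵀ y` -/

/-- The entrywise pairing of `k^{c×n}` with itself: `entryForm w` is the linear form
`y ↦ Σ_{a,d} w_{ad} y_{ad}` (it identifies the output space of `⟨c,m,n⟩` with the dual of the
second input space of `⟨c,c,n⟩`; this is the `Y ↦ Zᵀ, Z ↦ Yᵀ` part of the transpose symmetry).
[cite: Wang2026, §4.1] -/
def entryForm (w : Matrix (Fin c) (Fin n) k) : Module.Dual k (Matrix (Fin c) (Fin n) k) where
  toFun y := ∑ a, ∑ d, w a d * y a d
  map_add' y y' := by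
    simp only [Matrix.add_apply, mul_add, Finset.sum_add_distrib]
  map_smul' r y := by
    simp only [Matrix.smul_apply, smul_eq_mul, RingHom.id_apply, Finset.mul_sum, mul_left_comm]

/-- `entryForm w y = Σ_{a,d} w_{ad} y_{ad}`. [cite: Wang2026, §4.1] -/
@[simp] theorem entryForm_apply (w y : Matrix (Fin c) (Fin n) k) :
    entryForm w y = ∑ a, ∑ d, w a d * y a d := rfl

/-- The pairing is symmetric. [cite: Wang2026, §4.1] -/
theorem entryForm_comm (w y : Matrix (Fin c) (Fin n) k) : entryForm w y = entryForm y w := by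
  simp only [entryForm_apply, mul_comm]

/-- The key entry identity: `⟨x' E_{id}, y⟩ = (x'ᵀ y)_{id}`. [cite: Wang2026, §4.1] -/
theorem entryForm_mul_single (y : Matrix (Fin c) (Fin n) k) (x' : Matrix (Fin c) (Fin c) k)
    (i : Fin c) (d : Fin n) :
    entryForm y (x' * Matrix.single i d (1 : k)) = (x'ᵀ * y) i d := by
  simp only [entryForm_apply, mul_single_apply', mul_ite, mul_zero, Finset.sum_ite_eq',
    Finset.mem_univ, if_true]
  rw [Matrix.mul_apply]
  exact Finset.sum_congr rfl fun a _ => by rw [Matrix.transpose_apply, mul_comm]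

variable (k) in
/-- The bilinear map `(x', y) ↦ x'ᵀ y` on `k^{c×c} × k^{c×n}` (the image of `⟨c,c,n⟩` under the
transpose symmetry, before restricting the first argument). [cite: Wang2026, §4.1] -/
noncomputable def trMulBilin (c n : ℕ) :
    Matrix (Fin c) (Fin c) k →ₗ[k] Matrix (Fin c) (Fin n) k →ₗ[k] Matrix (Fin c) (Fin n) k :=
  (mulBilin k c c n).comp (Matrix.transposeLinearEquiv (Fin c) (Fin c) k k).toLinearMap

/-- `trMulBilin k c n x' y = x'ᵀ y`. [cite: Wang2026, §4.1] -/
@[simp] theorem trMulBilin_apply (x' : Matrix (Fin c) (Fin c) k) (y : Matrix (Fin c) (Fin n) k) :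
    trMulBilin k c n x' y = x'ᵀ * y := rfl

namespace BilinComp

/-- **The transpose symmetry as a transport of computations** (Wang 2026, §4.1, `X ↦ Xᵀ,
Y ↦ Zᵀ, Z ↦ Yᵀ`): a computation `x' y' = Σ_t f_t(x') g_t(y') w_t` of `(x', y') ↦ x' y'` on
`S' × k^{c×n}` yields the computation `x'ᵀ y = Σ_t f_t(x') ⟨w_t, y⟩ G_t` of `(x', y) ↦ x'ᵀ y` on
`S' × k^{c×n}` with the SAME index set — the output vectors become the forms on the second
argument (`⟨w_t, ·⟩`) and the second forms become the outputs (`(G_t)_{id} = g_t(E_{id})`).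
[cite: Wang2026, §4.1 with Lemma 1] -/
noncomputable def transposeDual {S' : Submodule k (Matrix (Fin c) (Fin c) k)}
    (β : BilinComp ((mulBilin k c c n).comp S'.subtype) ι) :
    BilinComp ((trMulBilin k c n).comp S'.subtype) ι where
  f := β.f
  g t := entryForm (β.w t)
  w t := Matrix.of fun i d => β.g t (Matrix.single i d (1 : k))
  map_eq_sum x y := by
    ext i d
    have h := congrArg (entryForm y) (β.map_eq_sum x (Matrix.single i d (1 : k)))
    simp only [LinearMap.comp_apply, Submodule.subtype_apply, mulBilin_apply, map_sum, map_smul,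
      smul_eq_mul, entryForm_mul_single] at h
    simp only [LinearMap.comp_apply, Submodule.subtype_apply, trMulBilin_apply]
    rw [h, Matrix.sum_apply]
    refine Finset.sum_congr rfl fun t _ => ?_
    rw [Matrix.smul_apply, Matrix.of_apply, smul_eq_mul, entryForm_comm y]
    ring

/-- The first forms are unchanged by `transposeDual`. [cite: Wang2026, §4.1] -/
@[simp] theorem transposeDual_f {S' : Submodule k (Matrix (Fin c) (Fin c) k)}
    (β : BilinComp ((mulBilin k c c n).comp S'.subtype) ι) : β.transposeDual.f = β.f := rfl

/-- The second forms of `transposeDual` are the pairings with the old outputs. [cite: Wang2026, §4.1] -/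
@[simp] theorem transposeDual_g {S' : Submodule k (Matrix (Fin c) (Fin c) k)}
    (β : BilinComp ((mulBilin k c c n).comp S'.subtype) ι) (t : ι) :
    β.transposeDual.g t = entryForm (β.w t) := rfl

/-- The outputs of `transposeDual` are the coefficient matrices of the old second forms.
[cite: Wang2026, §4.1] -/
@[simp] theorem transposeDual_w {S' : Submodule k (Matrix (Fin c) (Fin c) k)}
    (β : BilinComp ((mulBilin k c c n).comp S'.subtype) ι) (t : ι) :
    β.transposeDual.w t = Matrix.of fun i d => β.g t (Matrix.single i d (1 : k)) := rfl

/-- **Transport along a transposed sandwich** (Wang 2026, Lemma 1 for the symmetry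
`X ↦ P Xᵀ Q` of a square first factor, §4.1): if `P xᵀ Q ∈ S'` for all `x ∈ S`, with `P' P = 1`
and `Q Q' = 1`, a computation of `(x, y) ↦ x y` on `S' × k^{c×n}` gives one on `S × k^{c×n}`
with the same index set: `f̃_t(x) = f_t(P xᵀ Q)`, `g̃_t(y) = ⟨w_t, P'ᵀ y⟩`, `w̃_t = Q'ᵀ G_t`
(`x y = Q'ᵀ ((P xᵀ Q)ᵀ (P'ᵀ y))`). [cite: Wang2026, Lemma 1 and §4.1] -/
noncomputable def ofTransposeSandwichLE {S S' : Submodule k (Matrix (Fin c) (Fin c) k)}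
    (P P' Q Q' : Matrix (Fin c) (Fin c) k) (hP : P' * P = 1) (hQ : Q * Q' = 1)
    (hmap : ∀ x ∈ S, P * xᵀ * Q ∈ S')
    (β : BilinComp ((mulBilin k c c n).comp S'.subtype) ι) :
    BilinComp ((mulBilin k c c n).comp S.subtype) ι :=
  β.transposeDual.comap
    (LinearMap.codRestrict S'
      ((((mulLeftLin k P).comp (mulRightLin k Q)).comp
        (Matrix.transposeLinearEquiv (Fin c) (Fin c) k k).toLinearMap).comp S.subtype)
      (fun x => by
        have h := hmap x x.2
        rw [Matrix.mul_assoc] at h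
        exact h))
    (mulLeftLin k P'ᵀ) (mulLeftLin k Q'ᵀ)
    (fun x y => by
      show (x : Matrix (Fin c) (Fin c) k) * y
        = Q'ᵀ * ((P * ((x : Matrix (Fin c) (Fin c) k)ᵀ * Q))ᵀ * (P'ᵀ * y))
      rw [Matrix.transpose_mul, Matrix.transpose_mul, Matrix.transpose_transpose,
        ← Matrix.mul_assoc Q'ᵀ, ← Matrix.mul_assoc Q'ᵀ, ← Matrix.mul_assoc Q'ᵀ,
        ← Matrix.transpose_mul, hQ, Matrix.transpose_one, Matrix.one_mul, Matrix.mul_assoc,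
        ← Matrix.mul_assoc Pᵀ, ← Matrix.transpose_mul, hP, Matrix.transpose_one, Matrix.one_mul])

/-- The first forms of the transported computation: `f̃_t(x) = f_t(P xᵀ Q)`.
[cite: Wang2026, Lemma 1 and §4.1] -/
theorem ofTransposeSandwichLE_f {S S' : Submodule k (Matrix (Fin c) (Fin c) k)}
    (P P' Q Q' : Matrix (Fin c) (Fin c) k) (hP : P' * P = 1) (hQ : Q * Q' = 1)
    (hmap : ∀ x ∈ S, P * xᵀ * Q ∈ S')
    (β : BilinComp ((mulBilin k c c n).comp S'.subtype) ι) (t : ι) (x : S) :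
    (β.ofTransposeSandwichLE P P' Q Q' hP hQ hmap).f t x
      = β.f t ⟨P * (x : Matrix (Fin c) (Fin c) k)ᵀ * Q, hmap x x.2⟩ := by
  simp only [ofTransposeSandwichLE, comap, LinearMap.comp_apply, transposeDual_f]
  congr 1
  apply Subtype.ext
  exact (Matrix.mul_assoc P _ Q).symm

/-- **Plain transpose** (`P = Q = 1`): if `xᵀ ∈ S'` for all `x ∈ S`, a computation on
`S' × k^{c×n}` gives one on `S × k^{c×n}` with the same index set.
[cite: Wang2026, Lemma 1 and §4.1] -/
noncomputable def ofTransposeLE {S S' : Submodule k (Matrix (Fin c) (Fin c) k)}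
    (hmap : ∀ x ∈ S, xᵀ ∈ S') (β : BilinComp ((mulBilin k c c n).comp S'.subtype) ι) :
    BilinComp ((mulBilin k c c n).comp S.subtype) ι :=
  β.ofTransposeSandwichLE 1 1 1 1 (Matrix.one_mul 1) (Matrix.one_mul 1)
    (fun x hx => by simpa using hmap x hx)

end BilinComp

/-- **Wang 2026, Lemma 1 for the transpose symmetry, as a length statement**: if `P Sᵀ Q ⊆ S'`
for invertible `P, Q` (square first factor), and `XY` restricted to `S'` has a computation of
length `r`, then so has `XY` restricted to `S`; in particular constraint subspaces equivalent under
`(GL_c × GL_c) ⋊ C_2` have the same minimal length. [cite: Wang2026, Lemma 1 and §4.1] -/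
theorem exists_bilinComp_constrained_of_transposeSandwich
    {S S' : Submodule k (Matrix (Fin c) (Fin c) k)}
    (P P' Q Q' : Matrix (Fin c) (Fin c) k) (hP : P' * P = 1) (hQ : Q * Q' = 1)
    (hmap : ∀ x ∈ S, P * xᵀ * Q ∈ S') {r : ℕ}
    (h : Nonempty (BilinComp ((mulBilin k c c n).comp S'.subtype) (Fin r))) :
    Nonempty (BilinComp ((mulBilin k c c n).comp S.subtype) (Fin r)) :=
  ⟨h.some.ofTransposeSandwichLE P P' Q Q' hP hQ hmap⟩

/-- **The pure transpose case**: if `xᵀ ∈ S'` for all `x ∈ S` and `XY` restricted to `S'` has a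
computation of length `r`, then so has `XY` restricted to `S` (so `S` and `Sᵀ` have the same
minimal length). [cite: Wang2026, Lemma 1 and §4.1] -/
theorem exists_bilinComp_constrained_of_transpose
    {S S' : Submodule k (Matrix (Fin c) (Fin c) k)} (hmap : ∀ x ∈ S, xᵀ ∈ S') {r : ℕ}
    (h : Nonempty (BilinComp ((mulBilin k c c n).comp S'.subtype) (Fin r))) :
    Nonempty (BilinComp ((mulBilin k c c n).comp S.subtype) (Fin r)) :=
  ⟨h.some.ofTransposeLE hmap⟩

/-- **Lower-bound transfer** (the form a certificate checker uses for a transposed lookup): if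
`P xᵀ Q ∈ S'` for all `x ∈ S` and every computation of `XY` on `S × k^{c×n}` needs at least `b`
products, then so does every computation on `S' × k^{c×n}`. [cite: Wang2026, Lemma 1 and §4.1] -/
theorem forall_le_length_of_transposeSandwich
    {S S' : Submodule k (Matrix (Fin c) (Fin c) k)}
    (P P' Q Q' : Matrix (Fin c) (Fin c) k) (hP : P' * P = 1) (hQ : Q * Q' = 1)
    (hmap : ∀ x ∈ S, P * xᵀ * Q ∈ S') {b : ℕ}
    (hb : ∀ r, BilinComp ((mulBilin k c c n).comp S.subtype) (Fin r) → b ≤ r) (r : ℕ)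
    (β : BilinComp ((mulBilin k c c n).comp S'.subtype) (Fin r)) : b ≤ r :=
  hb r (β.ofTransposeSandwichLE P P' Q Q' hP hQ hmap)

end Literature.Computability.AlgebraicComplexity
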